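import Mathlib

/-!
# Tier7/Line3/ProductFormulaSeparation — the product formula forces archimedean growth (seat t7-x1)

LINE 3 (t7-plan-3), the two-torus relative trace formula; version (ii) of the isolation (p1 l. 14840 (2)(ii):
`L¹` matrix coefficients at the `U(1,1)`-places, INFINITE geometric side, one dominant term). The dominant-term
argument (`T7SupportDominantTermPolynomial.tail_le_half_of_polynomial`, p665226) consumes the hypothesis
«`size_of_arith`: an orbit `γ ≠ γ₀` carrying weight at depth `N` has `size γ ≥ ρ N`, `ρ N → ∞`». THIS FILE
supplies that hypothesis from the PRODUCT FORMULA of the number field `F` (`NumberField.prod_abs_eq_one`):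
for `x := κ γ − κ γ₀ ≠ 0` (`κ` separates regular double cosets, `T7SupportTwoTorusInvariant`) with
`|x|_{v₁} ≤ q⁻¹ ^ N` (the local congruence `hcong` of `T7SupportIsolation`), `|x|_w ≤ B w` at the finitely many
finite places `w ∈ S` (κ bounded on the compact supports of the test function) and `|x|_w ≤ 1` at every other
finite place (κ is `T_A × T_B`-invariant and integral on the maximal compact `K_w`), the archimedean absolute
values satisfy `∏_{w | ∞} |x|_w^{mult w} ≥ q ^ N / ∏_S B w`, hence SOME archimedean place sees
`|x|_w ≥ (q ^ N / C) ^ (1 / [F : ℚ]) → ∞`. No single place gives this; it is the global product formula.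

Mathlib only; nothing here is about a group, a double coset, an orbital integral or a period. Blind lane; no
sorry; axioms ⊆ {propext, Classical.choice, Quot.sound}.
-/

namespace Summit.Ventures.HodgeRepro2.Tier7.Line3.ProductFormulaSeparation

open NumberField Filter Topology

variable {K : Type*} [Field K] [NumberField K]

/-- **the finite product is positive** for `x ≠ 0` (every finite absolute value of a non-zero element is
positive, and only finitely many differ from `1`). -/
theorem finprod_finitePlace_pos (x : K) (hx : x ≠ 0) : 0 < ∏ᶠ w : FinitePlace K, w x := by
  rw [finprod_eq_prod_of_mulSupport_subset _ (s := (FinitePlace.hasFiniteMulSupport hx).toFinset)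
    (by intro w hw; simpa using hw)]
  exact Finset.prod_pos fun w _ => FinitePlace.pos_iff.2 hx

/-- **the archimedean product is the inverse of the finite product**: the product formula
`NumberField.prod_abs_eq_one` rearranged. -/
theorem prod_infinitePlace_eq_inv (x : K) (hx : x ≠ 0) :
    ∏ w : InfinitePlace K, w x ^ w.mult = (∏ᶠ w : FinitePlace K, w x)⁻¹ :=
  eq_inv_of_mul_eq_one_left (prod_abs_eq_one hx)

/-- **the finite product is bounded by the local bounds**: `|x|_{v₁} ≤ ε`, `|x|_w ≤ B w` on a finite set `S ∌ v₁`
and `|x|_w ≤ 1` elsewhere give `∏ᶠ_w |x|_w ≤ ε · ∏_{w ∈ S} B w` (no sign condition on `ε`, `B` is needed: the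
left factors are non-negative). -/
theorem finprod_finitePlace_le (x : K) (hx : x ≠ 0) (v₁ : FinitePlace K)
    (S : Finset (FinitePlace K)) (hv₁S : v₁ ∉ S) {ε : ℝ} (hv₁ : v₁ x ≤ ε)
    (B : FinitePlace K → ℝ) (hS : ∀ w ∈ S, w x ≤ B w)
    (hout : ∀ w, w ∉ S → w ≠ v₁ → w x ≤ 1) :
    ∏ᶠ w : FinitePlace K, w x ≤ ε * ∏ w ∈ S, B w := by
  classical
  set g : FinitePlace K → ℝ := fun w => if w = v₁ then ε else if w ∈ S then B w else 1 with hg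
  set U : Finset (FinitePlace K) :=
    (FinitePlace.hasFiniteMulSupport hx).toFinset ∪ insert v₁ S with hU
  have hsub : Function.mulSupport (fun w : FinitePlace K => w x) ⊆ U := by
    intro w hw
    simp only [hU, Finset.coe_union, Set.mem_union, Set.Finite.coe_toFinset]
    exact Or.inl hw
  rw [finprod_eq_prod_of_mulSupport_subset _ hsub]
  have hle : ∏ w ∈ U, w x ≤ ∏ w ∈ U, g w := by
    refine Finset.prod_le_prod (fun w _ => apply_nonneg w x) ?_
    intro w _
    simp only [hg]
    split_ifs with h1 h2
    · exact h1 ▸ hv₁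
    · exact hS w h2
    · exact hout w h2 h1
  have hgU : ∏ w ∈ U, g w = ∏ w ∈ insert v₁ S, g w := by
    symm
    refine Finset.prod_subset (by simp [hU]) ?_
    intro w _ hw
    simp only [Finset.mem_insert, not_or] at hw
    simp [hg, hw.1, hw.2]
  have hgS : ∏ w ∈ insert v₁ S, g w = ε * ∏ w ∈ S, B w := by
    rw [Finset.prod_insert hv₁S]
    simp only [hg, if_true]
    congr 1
    refine Finset.prod_congr rfl fun w hw => ?_
    have hne : w ≠ v₁ := fun h => hv₁S (h ▸ hw)
    simp [hne, hw]
  calc ∏ w ∈ U, w x ≤ ∏ w ∈ U, g w := hle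
    _ = ε * ∏ w ∈ S, B w := by rw [hgU, hgS]

/-- **some archimedean place is large**: under the bounds of `finprod_finitePlace_le` with `ε > 0`, `B > 0`
on `S`, there is an infinite place `w` with `|x|_w ^ [K : ℚ] ≥ (ε · ∏_S B)⁻¹`. -/
theorem exists_infinitePlace_pow_ge (x : K) (hx : x ≠ 0) (v₁ : FinitePlace K)
    (S : Finset (FinitePlace K)) (hv₁S : v₁ ∉ S) {ε : ℝ} (hε : 0 < ε) (hv₁ : v₁ x ≤ ε)
    (B : FinitePlace K → ℝ) (hBpos : ∀ w ∈ S, 0 < B w) (hS : ∀ w ∈ S, w x ≤ B w)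
    (hout : ∀ w, w ∉ S → w ≠ v₁ → w x ≤ 1) :
    ∃ w : InfinitePlace K, (ε * ∏ w ∈ S, B w)⁻¹ ≤ w x ^ Module.finrank ℚ K := by
  have hfin := finprod_finitePlace_le x hx v₁ S hv₁S hv₁ B hS hout
  have hC : 0 < ε * ∏ w ∈ S, B w := mul_pos hε (Finset.prod_pos hBpos)
  have hprod : (ε * ∏ w ∈ S, B w)⁻¹ ≤ ∏ w : InfinitePlace K, w x ^ w.mult := by
    rw [prod_infinitePlace_eq_inv x hx]
    exact inv_anti₀ (finprod_finitePlace_pos x hx) hfin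
  obtain ⟨w₀, -, hw₀⟩ :=
    Finset.exists_max_image Finset.univ (fun w : InfinitePlace K => w x) Finset.univ_nonempty
  refine ⟨w₀, ?_⟩
  calc (ε * ∏ w ∈ S, B w)⁻¹ ≤ ∏ w : InfinitePlace K, w x ^ w.mult := hprod
    _ ≤ ∏ w : InfinitePlace K, w₀ x ^ w.mult := by
        refine Finset.prod_le_prod (fun w _ => pow_nonneg (apply_nonneg w x) _) ?_
        intro w _
        exact pow_le_pow_left₀ (apply_nonneg w x) (hw₀ w (Finset.mem_univ w)) _
    _ = w₀ x ^ ∑ w : InfinitePlace K, w.mult := by rw [Finset.prod_pow_eq_pow_sum]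
    _ = w₀ x ^ Module.finrank ℚ K := by rw [InfinitePlace.sum_mult_eq]

/-- the lower bound `ρ` at depth `N`: `((∏_S B)⁻¹ · q ^ N) ^ (1 / n)`. -/
noncomputable def rho (C q : ℝ) (n : ℕ) (N : ℕ) : ℝ := (C⁻¹ * q ^ N) ^ ((n : ℝ)⁻¹)

/-- **`ρ N → ∞`** for `C > 0`, `q > 1`, `n ≠ 0`. -/
theorem tendsto_rho {C q : ℝ} (hC : 0 < C) (hq : 1 < q) {n : ℕ} (hn : n ≠ 0) :
    Tendsto (rho C q n) atTop atTop := by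
  have h1 : Tendsto (fun N : ℕ => C⁻¹ * q ^ N) atTop atTop :=
    (tendsto_pow_atTop_atTop_of_one_lt hq).const_mul_atTop (inv_pos.2 hC)
  have h2 : Tendsto (fun t : ℝ => t ^ ((n : ℝ)⁻¹)) atTop atTop :=
    tendsto_rpow_atTop (by positivity)
  exact h2.comp h1

/-- **some archimedean place is at least `ρ N`** when `|x|_{v₁} ≤ q⁻¹ ^ N` and the other finite places are
bounded as in `finprod_finitePlace_le`. -/
theorem exists_infinitePlace_rho_le (x : K) (hx : x ≠ 0) (v₁ : FinitePlace K)
    (S : Finset (FinitePlace K)) (hv₁S : v₁ ∉ S) {q : ℝ} (hq : 1 < q) (N : ℕ)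
    (hv₁ : v₁ x ≤ q⁻¹ ^ N)
    (B : FinitePlace K → ℝ) (hBpos : ∀ w ∈ S, 0 < B w) (hS : ∀ w ∈ S, w x ≤ B w)
    (hout : ∀ w, w ∉ S → w ≠ v₁ → w x ≤ 1) :
    ∃ w : InfinitePlace K, rho (∏ w ∈ S, B w) q (Module.finrank ℚ K) N ≤ w x := by
  have hq0 : 0 < q := zero_lt_one.trans hq
  have hε : 0 < q⁻¹ ^ N := pow_pos (inv_pos.2 hq0) N
  obtain ⟨w, hw⟩ := exists_infinitePlace_pow_ge x hx v₁ S hv₁S hε hv₁ B hBpos hS hout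
  refine ⟨w, ?_⟩
  have hCpos : 0 < ∏ w ∈ S, B w := Finset.prod_pos hBpos
  have hn : Module.finrank ℚ K ≠ 0 := Module.finrank_pos.ne'
  have hA : (∏ w ∈ S, B w)⁻¹ * q ^ N = (q⁻¹ ^ N * ∏ w ∈ S, B w)⁻¹ := by
    rw [mul_inv, inv_pow, inv_inv, mul_comm]
  have hA0 : 0 ≤ (∏ w ∈ S, B w)⁻¹ * q ^ N := by positivity
  unfold rho
  calc ((∏ w ∈ S, B w)⁻¹ * q ^ N) ^ ((Module.finrank ℚ K : ℝ)⁻¹)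
      ≤ (w x ^ Module.finrank ℚ K) ^ ((Module.finrank ℚ K : ℝ)⁻¹) := by
        refine Real.rpow_le_rpow hA0 ?_ (by positivity)
        rw [hA]; exact hw
    _ = w x := Real.pow_rpow_inv_natCast (apply_nonneg w x) hn

/-- **integrality is stable under differences** at a finite place: `|a|_w ≤ 1`, `|b|_w ≤ 1` ⇒ `|a − b|_w ≤ 1`
(the ultrametric inequality `FinitePlace.add_le`). -/
theorem sub_le_one_of_le_one (w : FinitePlace K) {a b : K} (ha : w a ≤ 1) (hb : w b ≤ 1) :
    w (a - b) ≤ 1 := by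
  have h := FinitePlace.add_le w a (-b)
  rw [← sub_eq_add_neg, map_neg_eq_map] at h
  exact h.trans (max_le ha hb)

/-- **bounds are stable under differences** at a finite place: `|a|_w ≤ c`, `|b|_w ≤ c` ⇒ `|a − b|_w ≤ c`. -/
theorem sub_le_of_le (w : FinitePlace K) {a b : K} {c : ℝ} (ha : w a ≤ c) (hb : w b ≤ c) :
    w (a - b) ≤ c := by
  have h := FinitePlace.add_le w a (-b)
  rw [← sub_eq_add_neg, map_neg_eq_map] at h
  exact h.trans (max_le ha hb)

section Orbits

variable {Orb : Type*}

/-- the archimedean size of `κ γ − κ γ₀`: the sum of its absolute values at the infinite places. -/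
noncomputable def archSize (κ : Orb → K) (γ₀ γ : Orb) : ℝ :=
  ∑ w : InfinitePlace K, w (κ γ - κ γ₀)

/-- the archimedean size is non-negative (a sum of absolute values). -/
theorem archSize_nonneg (κ : Orb → K) (γ₀ γ : Orb) : 0 ≤ archSize κ γ₀ γ :=
  Finset.sum_nonneg fun w _ => apply_nonneg w _

/-- **the `size_of_arith` hypothesis of `tail_le_half_of_polynomial`, from the product formula**: with
`κ : Orb → K` separating `γ₀` (`hsep`), a local congruence to depth `N` at `v₁` on the orbits carrying weight
(`hcong`), bounds at the finite places of `S` (`hS`) and integrality at every other finite place (`hout`), every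
orbit `γ ≠ γ₀` carrying weight at depth `N` has `archSize κ γ₀ γ ≥ ρ N`, where
`ρ N = ((∏_S B)⁻¹ · q ^ N) ^ (1 / [K : ℚ]) → ∞` (`tendsto_rho`). -/
theorem rho_le_archSize (κ : Orb → K) (γ₀ : Orb) (arith : ℕ → Orb → Prop)
    (v₁ : FinitePlace K) (S : Finset (FinitePlace K)) (hv₁S : v₁ ∉ S) {q : ℝ} (hq : 1 < q)
    (B : FinitePlace K → ℝ) (hBpos : ∀ w ∈ S, 0 < B w)
    (hcong : ∀ N γ, arith N γ → v₁ (κ γ - κ γ₀) ≤ q⁻¹ ^ N)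
    (hS : ∀ N γ, arith N γ → ∀ w ∈ S, w (κ γ - κ γ₀) ≤ B w)
    (hout : ∀ N γ, arith N γ → ∀ w, w ∉ S → w ≠ v₁ → w (κ γ - κ γ₀) ≤ 1)
    (hsep : ∀ γ, κ γ = κ γ₀ → γ = γ₀) :
    ∀ N γ, arith N γ → γ ≠ γ₀ →
      rho (∏ w ∈ S, B w) q (Module.finrank ℚ K) N ≤ archSize κ γ₀ γ := by
  intro N γ hγ hne
  have hx : κ γ - κ γ₀ ≠ 0 := fun h => hne (hsep γ (sub_eq_zero.1 h))
  obtain ⟨w, hw⟩ := exists_infinitePlace_rho_le (κ γ - κ γ₀) hx v₁ S hv₁S hq N (hcong N γ hγ) B hBpos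
    (hS N γ hγ) (hout N γ hγ)
  refine hw.trans ?_
  exact Finset.single_le_sum (fun w _ => apply_nonneg w _) (Finset.mem_univ w)

end Orbits

open scoped Classical in
/-- **the product over a set `T` of infinite places is large** when, besides the finite-place bounds of
`exists_infinitePlace_pow_ge`, the infinite places OUTSIDE `T` are bounded by `Binf` (for LINE 3: `T` = the
two `U(1,1)`-places `ι₂, ι₃`; at the definite place `ι₁` the invariant `κ` is bounded by `1` on the compact
group, so `|κ γ − κ γ₀|_{ι₁} ≤ 1 + |κ γ₀|_{ι₁}`). -/
theorem prod_infinitePlace_subset_ge (x : K) (hx : x ≠ 0) (v₁ : FinitePlace K)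
    (S : Finset (FinitePlace K)) (hv₁S : v₁ ∉ S) {ε : ℝ} (hε : 0 < ε) (hv₁ : v₁ x ≤ ε)
    (B : FinitePlace K → ℝ) (hBpos : ∀ w ∈ S, 0 < B w) (hS : ∀ w ∈ S, w x ≤ B w)
    (hout : ∀ w, w ∉ S → w ≠ v₁ → w x ≤ 1)
    (T : Finset (InfinitePlace K)) (Binf : InfinitePlace K → ℝ) (hBinf : ∀ w ∉ T, 0 < Binf w)
    (hT : ∀ w ∉ T, w x ≤ Binf w) :
    (ε * (∏ w ∈ S, B w) * ∏ w ∈ Tᶜ, Binf w ^ w.mult)⁻¹ ≤ ∏ w ∈ T, w x ^ w.mult := by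
  classical
  have hfin := finprod_finitePlace_le x hx v₁ S hv₁S hv₁ B hS hout
  have hC : 0 < ε * ∏ w ∈ S, B w := mul_pos hε (Finset.prod_pos hBpos)
  have hprod : (ε * ∏ w ∈ S, B w)⁻¹ ≤ ∏ w : InfinitePlace K, w x ^ w.mult := by
    rw [prod_infinitePlace_eq_inv x hx]
    exact inv_anti₀ (finprod_finitePlace_pos x hx) hfin
  have hD : 0 < ∏ w ∈ Tᶜ, Binf w ^ w.mult :=
    Finset.prod_pos fun w hw => pow_pos (hBinf w (Finset.mem_compl.1 hw)) _
  have hsplit : ∏ w : InfinitePlace K, w x ^ w.mult =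
      (∏ w ∈ T, w x ^ w.mult) * ∏ w ∈ Tᶜ, w x ^ w.mult :=
    (Finset.prod_mul_prod_compl T _).symm
  have hcompl : ∏ w ∈ Tᶜ, w x ^ w.mult ≤ ∏ w ∈ Tᶜ, Binf w ^ w.mult := by
    refine Finset.prod_le_prod (fun w _ => pow_nonneg (apply_nonneg w x) _) ?_
    intro w hw
    exact pow_le_pow_left₀ (apply_nonneg w x) (hT w (Finset.mem_compl.1 hw)) _
  have hTnn : 0 ≤ ∏ w ∈ T, w x ^ w.mult :=
    Finset.prod_nonneg fun w _ => pow_nonneg (apply_nonneg w x) _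
  have key : (ε * ∏ w ∈ S, B w)⁻¹ ≤ (∏ w ∈ T, w x ^ w.mult) * ∏ w ∈ Tᶜ, Binf w ^ w.mult :=
    hprod.trans (by rw [hsplit]; exact mul_le_mul_of_nonneg_left hcompl hTnn)
  rw [mul_inv, ← div_eq_mul_inv, div_le_iff₀ hD]
  exact key

/-- **`ρ N → ∞`** for the linear form `ρ N = C⁻¹ · q ^ N` (`C > 0`, `q > 1`). -/
theorem tendsto_inv_mul_pow {C q : ℝ} (hC : 0 < C) (hq : 1 < q) :
    Tendsto (fun N : ℕ => C⁻¹ * q ^ N) atTop atTop :=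
  (tendsto_pow_atTop_atTop_of_one_lt hq).const_mul_atTop (inv_pos.2 hC)

section OrbitsProduct

variable {Orb : Type*}

/-- the archimedean size of `κ γ − κ γ₀` over a set `T` of infinite places: `∏_{w ∈ T} |κ γ − κ γ₀|_w^{mult w}`
(for LINE 3, `T = {ι₂, ι₃}`: the product that the two `U(1,1)`-coefficients decay in). -/
noncomputable def archSizeOn (T : Finset (InfinitePlace K)) (κ : Orb → K) (γ₀ γ : Orb) : ℝ :=
  ∏ w ∈ T, w (κ γ - κ γ₀) ^ w.mult

omit [NumberField K] in
/-- the archimedean size over `T` is non-negative. -/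
theorem archSizeOn_nonneg (T : Finset (InfinitePlace K)) (κ : Orb → K) (γ₀ γ : Orb) :
    0 ≤ archSizeOn T κ γ₀ γ :=
  Finset.prod_nonneg fun w _ => pow_nonneg (apply_nonneg w _) _

open scoped Classical in
/-- **the `size_of_arith` hypothesis with the PRODUCT size over `T`, from the product formula**: with the
finite-place data of `rho_le_archSize` and the infinite places outside `T` bounded (`hT`), every orbit
`γ ≠ γ₀` carrying weight at depth `N` has `archSizeOn T κ γ₀ γ ≥ C⁻¹ · q ^ N`, `C = ∏_S B · ∏_{Tᶜ} Binf^{mult}`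
(`tendsto_inv_mul_pow`: `→ ∞`). -/
theorem inv_mul_pow_le_archSizeOn (κ : Orb → K) (γ₀ : Orb) (arith : ℕ → Orb → Prop)
    (v₁ : FinitePlace K) (S : Finset (FinitePlace K)) (hv₁S : v₁ ∉ S) {q : ℝ} (hq : 1 < q)
    (B : FinitePlace K → ℝ) (hBpos : ∀ w ∈ S, 0 < B w)
    (T : Finset (InfinitePlace K)) (Binf : InfinitePlace K → ℝ) (hBinf : ∀ w ∉ T, 0 < Binf w)
    (hcong : ∀ N γ, arith N γ → v₁ (κ γ - κ γ₀) ≤ q⁻¹ ^ N)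
    (hS : ∀ N γ, arith N γ → ∀ w ∈ S, w (κ γ - κ γ₀) ≤ B w)
    (hout : ∀ N γ, arith N γ → ∀ w, w ∉ S → w ≠ v₁ → w (κ γ - κ γ₀) ≤ 1)
    (hT : ∀ N γ, arith N γ → ∀ w ∉ T, w (κ γ - κ γ₀) ≤ Binf w)
    (hsep : ∀ γ, κ γ = κ γ₀ → γ = γ₀) :
    ∀ N γ, arith N γ → γ ≠ γ₀ →
      ((∏ w ∈ S, B w) * ∏ w ∈ Tᶜ, Binf w ^ w.mult)⁻¹ * q ^ N ≤ archSizeOn T κ γ₀ γ := by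
  intro N γ hγ hne
  have hx : κ γ - κ γ₀ ≠ 0 := fun h => hne (hsep γ (sub_eq_zero.1 h))
  have hq0 : 0 < q := zero_lt_one.trans hq
  have hε : 0 < q⁻¹ ^ N := pow_pos (inv_pos.2 hq0) N
  have h := prod_infinitePlace_subset_ge (κ γ - κ γ₀) hx v₁ S hv₁S hε (hcong N γ hγ) B hBpos
    (hS N γ hγ) (hout N γ hγ) T Binf hBinf (hT N γ hγ)
  have e : ((q⁻¹ ^ N * ∏ w ∈ S, B w) * ∏ w ∈ Tᶜ, Binf w ^ w.mult)⁻¹ =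
      ((∏ w ∈ S, B w) * ∏ w ∈ Tᶜ, Binf w ^ w.mult)⁻¹ * q ^ N := by
    rw [inv_pow, mul_inv, mul_inv, inv_inv]; ring
  rw [e] at h
  exact h

end OrbitsProduct

end Summit.Ventures.HodgeRepro2.Tier7.Line3.ProductFormulaSeparation
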